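import Mathlib
import HarnessLib

/-!
# `NoHeavyLowerTail` (stmt-CriticalPhenomena-4575) — two-port peeling, one shared port: the certificate algebra (all levels)

Route `PercNearOneGluingNoHeavy`, seat `prim-gen-swap` (gen 5); memo TWO-PORT-PEELING.md §6, §12, §14.  Two two-port stars sharing
one relay, `u = {a, x}` (`θ_u = t`), `v = {x, b}` (`θ_v = s`), champion `c ∉ {a, x, b}`.  With the indicators `σ, ξ, β`
(loneliness of `c, x, b`), `α₂ = [B(a) ∪ B(x) small]`, `β₂ = [B(x) ∪ B(b) small]`, `λ_b = [b ∼ a ∨ b ∼ x]` and the attachment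
complements `k_a, k_x, k_b` (`k_y = 1 − [c ∼ y]`), the quantity `E∅∅_shared` and the champion rows are
`E = (1−t)(1−s)σ + t(1−s)(σ k_a k_x − α₂) + (1−t)s(σ k_x k_b − β₂) + ts σ k_a k_x k_b`,
`K_x = E − (1−t)(1−s)ξ`, `K_b = (1−t)(1−s)(σ−β) + t(1−s)(σ k_a k_x − β(1−λ_b)) + (1−t)s(σ k_x k_b − β₂) + ts σ k_a k_x k_b`.
This file proves the pointwise certificate `E ≥ t·K_x + s(1−t)·K_b` for all admissible reals (only signs, `λ_b ≤ 1`, `α₂ ≤ ξ` and `β₂ ≤ β` are used)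
(valid at every level `j`), via the identity `E − tK_x − s(1−t)K_b = (1−t)(1−s)·[E_c + t(ξ−α₂) + sβ(1−tλ_b) − s(1−t)β₂]`.
Pure real arithmetic; no definitions, no named facts, no sorries.
-/

namespace Summit.CriticalPhenomena.PercolationContinuityZ3.Theorems

namespace TwoPortPeeling

/-- **Shared-port certificate (all levels).**  For `t, s ∈ [0,1]`, `σ, k_a, k_x, k_b, β₂ ≥ 0`, `λ_b ≤ 1`,
`α₂ ≤ ξ`, `β₂ ≤ β` (in particular for all level-`j` indicators):
`t·K_x + s(1−t)·K_b ≤ E∅∅_shared` (notation of the file header). [this file; memo TWO-PORT-PEELING.md §12] -/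
theorem shared_certificate_algebra (t s σ ξ α₂ β β₂ lb ka kx kb : ℝ)
    (ht0 : 0 ≤ t) (ht1 : t ≤ 1) (hs0 : 0 ≤ s) (hs1 : s ≤ 1) (hσ0 : 0 ≤ σ)
    (hαξ : α₂ ≤ ξ) (hβ20 : 0 ≤ β₂) (hβ2β : β₂ ≤ β)
    (hl1 : lb ≤ 1) (hka0 : 0 ≤ ka) (hkx0 : 0 ≤ kx) (hkb0 : 0 ≤ kb) :
    t * (((1 - t) * (1 - s) * σ + t * (1 - s) * (σ * ka * kx - α₂) + (1 - t) * s * (σ * kx * kb - β₂) +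
          t * s * (σ * ka * kx * kb)) - (1 - t) * (1 - s) * ξ) +
      s * (1 - t) * ((1 - t) * (1 - s) * (σ - β) + t * (1 - s) * (σ * ka * kx - β * (1 - lb)) +
          (1 - t) * s * (σ * kx * kb - β₂) + t * s * (σ * ka * kx * kb)) ≤
      (1 - t) * (1 - s) * σ + t * (1 - s) * (σ * ka * kx - α₂) + (1 - t) * s * (σ * kx * kb - β₂) +
        t * s * (σ * ka * kx * kb) := by
  have h1t : 0 ≤ 1 - t := sub_nonneg.2 ht1
  have h1s : 0 ≤ 1 - s := sub_nonneg.2 hs1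
  -- the bracket: E_c + t(ξ−α₂) + sβ(1−tλ_b) − s(1−t)β₂ ≥ 0
  have hEc : 0 ≤ σ * ((1 - t) * (1 - s) + t * (1 - s) * (ka * kx) + (1 - t) * s * (kx * kb) + t * s * (ka * kx * kb)) :=
    mul_nonneg hσ0 (by
      have := mul_nonneg (mul_nonneg ht0 h1s) (mul_nonneg hka0 hkx0)
      have := mul_nonneg (mul_nonneg h1t hs0) (mul_nonneg hkx0 hkb0)
      have := mul_nonneg (mul_nonneg ht0 hs0) (mul_nonneg (mul_nonneg hka0 hkx0) hkb0)
      nlinarith [mul_nonneg h1t h1s])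
  have hb1 : s * (1 - t) * β₂ ≤ s * β * (1 - t * lb) := by
    have e1 : s * (1 - t) * β₂ ≤ s * (1 - t) * β := mul_le_mul_of_nonneg_left hβ2β (mul_nonneg hs0 h1t)
    have e2 : s * (1 - t) * β ≤ s * β * (1 - t * lb) := by
      have : t * lb ≤ t := by nlinarith
      have hβ0 : 0 ≤ β := hβ20.trans hβ2β
      nlinarith [mul_nonneg hs0 hβ0]
    exact e1.trans e2
  have hbr : 0 ≤ σ * ((1 - t) * (1 - s) + t * (1 - s) * (ka * kx) + (1 - t) * s * (kx * kb) + t * s * (ka * kx * kb)) +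
      t * (ξ - α₂) + (s * β * (1 - t * lb) - s * (1 - t) * β₂) := by
    have : 0 ≤ t * (ξ - α₂) := mul_nonneg ht0 (sub_nonneg.2 hαξ)
    linarith
  have key := mul_nonneg (mul_nonneg h1t h1s) hbr
  nlinarith [key]

end TwoPortPeeling

end Summit.CriticalPhenomena.PercolationContinuityZ3.Theorems
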